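import Mathlib
import Literature.NumberTheory.Sieve.LiouvillePolynomialValuesWeylTopCoeff
import HarnessLib

/-!
# Weyl's inequality in inverse form for all coefficients (Green–Tao 2012, Proposition 4.3)

Support file (everything PROVED; no definitions, no named facts) towards the named fact
`Literature.NumberTheory.Sieve.teravainen2024_cor_2_1` (J. Teräväinen, *On the Liouville function
at polynomial arguments*, Amer. J. Math. 146 (2024) = arXiv:2010.07924, Corollary 2.1 ⊂
Theorem 2.6, proved in §5). Lemma 5.6 there (the Erdős–Turán step of the minor-arc case of
Proposition 5.4) needs, for `x ∈ 𝒳₂` — i.e. when the coefficients of the polynomial phase `P_x`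
do NOT all admit rational approximations `|c_j - a_j/q_j| ≤ 1/(q_j (H/L)^j)`, `|a_j|, q_j ≤ L` —
that all the Weyl sums `𝔼_{x≤n≤x+H} e(j P_x(n))`, `1 ≤ j ≤ M₀`, are small: "by the assumption
`x ∈ 𝒳₂` and standard estimates for Weyl sums (see [Green–Tao, Ann. of Math. 175 (2012)])".
The estimate meant is the quantitative Weyl dichotomy

> **[GT12, Proposition 4.3]** (Weyl). Suppose that `g : ℤ → ℝ` is a polynomial of degree `d`,
> and let `0 < δ < 1/2`. Then either `(g(n) mod ℤ)_{n∈[N]}` is `δ`-equidistributed, or else there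
> is an integer `1 ≤ k ≪ δ^{-O_d(1)}` such that `‖kg mod ℤ‖_{C^∞[N]} ≪ δ^{-O_d(1)}`,

whose exponential-sum core (the case where `|𝔼_{n∈[N]} e(g(n))| ≥ δ` is given) is proved in
loc. cit. by a descent on the coefficients from the top one (Lemma 4.4, the tree's
`Teravainen2024.weyl_topCoeff`, `LiouvillePolynomialValuesWeylTopCoeff.lean`): "suppose as a
hypothesis for induction on `r` that each of the coefficients `α_d, …, α_{d-r}` is nearly rational
[…] Set `Q := q d!` […] `g'(n₀ + Qn') - g'(n₀) = g(n₀ + Qn') - g(n₀) + O(δ^{C'_d - O(1)}) mod ℤ`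
[…] Splitting `[N]` into progressions of common difference `Q` and length `N'` […] there is `n₀`
such that `|𝔼_{n'∈[N']} e(g'(n₀ + Qn'))| ≫ δ^{O(1)}` […] By Lemma 4.4 the leading coefficient
`Q^{d-r-1} α_{d-r-1}` of this polynomial is nearly rational […]" (arXiv:0709.3562, pp. 14–15).

This file formalizes that descent (`Teravainen2024.weyl_allCoeffs`) in the monomial basis (where
`Q = q` suffices, `(n₀+qn')^i - n₀^i` being divisible by `q`) with existential constants of the
shape `C (8/δ²)^A` per degree, for real polynomials `p ∈ ℝ[X]` of degree `≤ d` and the Weyl sum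
over `(0, L]`: some `1 ≤ q ≤ C(8/δ²)^A` has `‖q p_i‖_{ℝ/ℤ} ≤ C (8/δ²)^A / L^i` for ALL `1 ≤ i ≤ d`
(`‖·‖_{ℝ/ℤ}` = `Literature.NumberTheory.Sieve.Vinogradov.distInt`). Ingredients:

* `Teravainen2024.exists_progression_large` — averaging: a progression `n₀ + q t`, `0 < t ≤ N'`,
  inside `(0, L]` carries a Weyl sum `≥ δN'/4` when `4qN' ≤ δL`;
* `Teravainen2024.exists_int_near_tail_sub`, `norm_sum_e_progression_le` — along such a
  progression the tail `∑_{i>m} p_i n^i` is an integer plus `O(∑_{i>m} ‖q p_i‖ N' i L^{i-1})`;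
* `Teravainen2024.exists_affineComp` — `t ↦ p_{≤m}(n₀ + qt)` is a polynomial of degree `≤ m`
  with top coefficient `q^m p_m` (via Mathlib's `Polynomial.taylor`);
* `Teravainen2024.weyl_descend` — one descent step (constants
  `E = A₁ + A₂ + (2A₁+1)d + A₁d`, `C' = C₂ 64^{A₂} (128 d² C₁²)^{2d+1}`), with its bookkeeping
  lemmas `weyl_descend_params`, `descent_*`;
* `Teravainen2024.weyl_coeffs_from_top`, `weyl_allCoeffs` — the induction on `r` and the result;
* `Teravainen2024.weyl_sums_small_of_minorArc` — the contrapositive as used in Lemma 5.6: if no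
  `q ≤ J₀ C(8/δ²)^A` makes all `‖q p_i‖ ≤ C(8/δ²)^A/L^i`, then `‖∑_{0<n≤L} e(j p(n))‖ < δL` for
  all `1 ≤ j ≤ J₀`.

## References
* B. Green, T. Tao, Ann. of Math. 175 (2012), 465–540, §4, Proposition 4.3 and its proof
  (arXiv:0709.3562, pp. 14–15). [GreenTao2012Nilmanifolds]
* J. Teräväinen, Amer. J. Math. 146 (2024), §5.4, Lemma 5.6. [Teravainen2024]
-/

noncomputable section

open Finset

namespace Literature.NumberTheory.Sieve

namespace Teravainen2024

open Polynomial
open Literature.NumberTheory.LFunctions Literature.NumberTheory.Sieve.Vinogradov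

/-! ### Small tools -/

/-- `‖n x‖ ≤ n ‖x‖` for `n ∈ ℕ`. [folklore] -/
theorem distInt_natMul_le (n : ℕ) (x : ℝ) : distInt (n * x) ≤ n * distInt x := by
  calc distInt (n * x) ≤ |n * x - ((n * round x : ℤ) : ℝ)| := distInt_le_abs_sub_int _ _
    _ = n * distInt x := by
        unfold distInt
        push_cast
        rw [← mul_sub, abs_mul, abs_of_nonneg (Nat.cast_nonneg n)]

/-- `‖e(x) - 1‖ ≤ 2π |x|`. [folklore] -/
theorem norm_e_sub_one_le (x : ℝ) : ‖VdC.e x - 1‖ ≤ 2 * Real.pi * |x| := by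
  rw [VdC.e_sub_one_eq]
  have h1 : (-(Real.sin (Real.pi * x) : ℂ) + (Real.cos (Real.pi * x) : ℂ) * Complex.I) =
      Complex.I * Complex.exp ((Real.pi * x : ℝ) * Complex.I) := by
    rw [Complex.exp_mul_I, ← Complex.ofReal_cos, ← Complex.ofReal_sin]
    ring_nf
    rw [Complex.I_sq]
    ring
  rw [h1, norm_mul, norm_mul, norm_mul, Complex.norm_I, Complex.norm_exp_ofReal_mul_I,
    Complex.norm_real, Complex.norm_ofNat, Real.norm_eq_abs, one_mul, mul_one]
  have h2 : |Real.sin (Real.pi * x)| ≤ |Real.pi * x| := by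
    have := Real.abs_sin_sub_sin_le (Real.pi * x) 0
    simpa using this
  rw [abs_mul, abs_of_pos Real.pi_pos] at h2
  linarith

/-- `‖e(y + E) - e(y)‖ ≤ 2π|E|`. [folklore] -/
theorem norm_e_add_sub_e_le (y E : ℝ) : ‖VdC.e (y + E) - VdC.e y‖ ≤ 2 * Real.pi * |E| := by
  rw [VdC.e_add, ← mul_sub_one, norm_mul, VdC.norm_e, one_mul]
  exact norm_e_sub_one_le E

/-! ### Truncation and affine reparametrisation of polynomials -/

/-- The truncation `∑_{i≤m} p_i X^i` has degree `≤ m`. [folklore] -/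
theorem natDegree_trunc_le (p : ℝ[X]) (m : ℕ) :
    (∑ i ∈ Finset.range (m + 1), C (p.coeff i) * X ^ i).natDegree ≤ m := by
  refine Polynomial.natDegree_sum_le_of_forall_le _ _ fun i hi => ?_
  rw [Finset.mem_range] at hi
  exact (Polynomial.natDegree_C_mul_X_pow_le _ _).trans (by omega)

/-- Coefficients of the truncation. [folklore] -/
theorem coeff_trunc (p : ℝ[X]) (m j : ℕ) :
    (∑ i ∈ Finset.range (m + 1), C (p.coeff i) * X ^ i).coeff j = if j ≤ m then p.coeff j else 0 := by
  rw [Polynomial.finsetSum_coeff]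
  simp only [Polynomial.coeff_C_mul_X_pow]
  split_ifs with h
  · rw [Finset.sum_eq_single j]
    · simp
    · intro i _ hij
      rw [if_neg (Ne.symm hij)]
    · intro hj
      rw [Finset.mem_range] at hj
      omega
  · refine Finset.sum_eq_zero fun i hi => ?_
    rw [Finset.mem_range] at hi
    rw [if_neg (by omega)]

/-- Values of the tail `p - trunc_m p`: for `deg p ≤ d`,
`(p - trunc)(x) - (p - trunc)(y) = ∑_{m<i≤d} p_i (x^i - y^i)`. [folklore] -/
theorem eval_tail_sub {p : ℝ[X]} {d m : ℕ} (hp : p.natDegree ≤ d) (hmd : m ≤ d) (x y : ℝ) :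
    (p - ∑ i ∈ Finset.range (m + 1), C (p.coeff i) * X ^ i).eval x -
      (p - ∑ i ∈ Finset.range (m + 1), C (p.coeff i) * X ^ i).eval y =
        ∑ i ∈ Finset.Ioc m d, p.coeff i * (x ^ i - y ^ i) := by
  have hdecomp : p = (∑ i ∈ Finset.range (m + 1), C (p.coeff i) * X ^ i) +
      ∑ i ∈ Finset.Ioc m d, C (p.coeff i) * X ^ i := by
    have h : Finset.range (d + 1) = Finset.range (m + 1) ∪ Finset.Ioc m d := by
      ext i
      simp only [Finset.mem_union, Finset.mem_range, Finset.mem_Ioc]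
      omega
    have hdisj : Disjoint (Finset.range (m + 1)) (Finset.Ioc m d) := by
      rw [Finset.disjoint_left]
      intro i hi hi'
      rw [Finset.mem_range] at hi
      rw [Finset.mem_Ioc] at hi'
      omega
    conv_lhs => rw [p.as_sum_range_C_mul_X_pow' (show p.natDegree < d + 1 by omega)]
    rw [h, Finset.sum_union hdisj]
  have hev : ∀ z : ℝ, (p - ∑ i ∈ Finset.range (m + 1), C (p.coeff i) * X ^ i).eval z =
      ∑ i ∈ Finset.Ioc m d, p.coeff i * z ^ i := by
    intro z
    have h1 := congrArg (Polynomial.eval z) hdecomp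
    rw [Polynomial.eval_add] at h1
    rw [Polynomial.eval_sub, h1, add_sub_cancel_left, Polynomial.eval_finsetSum]
    refine Finset.sum_congr rfl fun i _ => ?_
    simp only [Polynomial.eval_mul, Polynomial.eval_C, Polynomial.eval_pow, Polynomial.eval_X]
  rw [hev, hev, ← Finset.sum_sub_distrib]
  refine Finset.sum_congr rfl fun i _ => ?_
  ring

/-- **Affine reparametrisation.** For `g` of degree `≤ m` and reals `n₀, q`, the polynomial
`P(X) = ∑_{i≤m} (taylor n₀ g)_i q^i X^i` satisfies `P(t) = g(n₀ + q t)`, `deg P ≤ m` and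
`[X^m] P = q^m [X^m] g`. [folklore] -/
theorem exists_affineComp {g : ℝ[X]} {m : ℕ} (hg : g.natDegree ≤ m) (n₀ q : ℝ) :
    ∃ P : ℝ[X], P.natDegree ≤ m ∧ P.coeff m = q ^ m * g.coeff m ∧
      ∀ t : ℝ, P.eval t = g.eval (n₀ + q * t) := by
  set g₁ : ℝ[X] := Polynomial.taylor n₀ g with hg₁
  have hg₁deg : g₁.natDegree ≤ m := by rw [hg₁, Polynomial.natDegree_taylor]; exact hg
  have hg₁m : g₁.coeff m = g.coeff m := by
    rw [hg₁, coeff_taylor_eq_sum, Finset.sum_eq_single 0]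
    · simp
    · intro j _ hj
      rw [Polynomial.coeff_eq_zero_of_natDegree_lt (by omega)]
      simp
    · intro h0
      exact absurd (Finset.mem_range.mpr (Nat.succ_pos _)) h0
  refine ⟨∑ i ∈ Finset.range (m + 1), C (g₁.coeff i * q ^ i) * X ^ i, ?_, ?_, ?_⟩
  · refine Polynomial.natDegree_sum_le_of_forall_le _ _ fun i hi => ?_
    rw [Finset.mem_range] at hi
    exact (Polynomial.natDegree_C_mul_X_pow_le _ _).trans (by omega)
  · rw [Polynomial.finsetSum_coeff]
    simp only [Polynomial.coeff_C_mul_X_pow]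
    rw [Finset.sum_eq_single m]
    · simp [hg₁m, mul_comm]
    · intro i _ him
      rw [if_neg (Ne.symm him)]
    · intro hm
      exact absurd (Finset.mem_range.mpr (Nat.lt_succ_self m)) hm
  · intro t
    have h1 : g.eval (n₀ + q * t) = g₁.eval (q * t) := by
      rw [hg₁, Polynomial.taylor_eval]
      ring_nf
    rw [h1, Polynomial.eval_finsetSum, Polynomial.eval_eq_sum_range' (n := m + 1)
      (lt_of_le_of_lt hg₁deg (Nat.lt_succ_self m))]
    refine Finset.sum_congr rfl fun i _ => ?_
    simp only [Polynomial.eval_mul, Polynomial.eval_C, Polynomial.eval_pow, Polynomial.eval_X]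
    ring

/-! ### Averaging a Weyl sum over progressions -/

/-- **Sub-progressions carry a large Weyl sum.** Let `f : ℤ → ℂ` be `1`-bounded, `q, N' ≥ 1`
with `4 q N' ≤ δ L`, and `‖∑_{0<n≤L} f(n)‖ ≥ δ L`. Then some `0 ≤ n₀ ≤ L - qN'` has
`‖∑_{0<t≤N'} f(n₀ + q t)‖ ≥ δ N'/4`. (Average over `n₀`: each `n ∈ (0, L]` is `n₀ + qt` for
exactly `N'` pairs; the `≤ 2qN'` boundary values of `n₀` contribute `≤ 2qN'²`.) [folklore] -/
theorem exists_progression_large {f : ℤ → ℂ} (hf : ∀ n, ‖f n‖ ≤ 1) {L q N' : ℕ} (hq : 1 ≤ q)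
    (hN' : 1 ≤ N') {δ : ℝ} (hδ : 0 < δ) (hqN : 4 * (q : ℝ) * N' ≤ δ * L)
    (hS : δ * L ≤ ‖∑ n ∈ Finset.Ioc (0 : ℤ) L, f n‖) :
    ∃ n₀ : ℤ, 0 ≤ n₀ ∧ n₀ + q * N' ≤ L ∧
      δ * N' / 4 ≤ ‖∑ t ∈ Finset.Ioc (0 : ℤ) N', f (n₀ + q * t)‖ := by
  classical
  have hqpos : (0 : ℝ) < q := by exact_mod_cast hq
  have hN'pos : (0 : ℝ) < N' := by exact_mod_cast hN'
  have hLpos : (0 : ℝ) < L := by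
    have : (0 : ℝ) < 4 * (q : ℝ) * N' := by positivity
    nlinarith
  have hnormL : ‖∑ n ∈ Finset.Ioc (0 : ℤ) L, f n‖ ≤ L := by
    refine (norm_sum_le _ _).trans ?_
    calc ∑ n ∈ Finset.Ioc (0 : ℤ) L, ‖f n‖ ≤ ∑ n ∈ Finset.Ioc (0 : ℤ) L, (1 : ℝ) :=
          Finset.sum_le_sum fun n _ => hf n
      _ = L := by simp
  have hδle1 : δ ≤ 1 := by
    by_contra h
    rw [not_le] at h
    nlinarith [hS.trans hnormL]
  have hqNL : (q : ℝ) * N' ≤ L := by nlinarith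
  have hqNLZ : (q : ℤ) * N' ≤ L := by exact_mod_cast hqNL
  have h1qR : (1 : ℝ) ≤ q := by exact_mod_cast hq
  have h1NR : (1 : ℝ) ≤ N' := by exact_mod_cast hN'
  have hL1 : (1 : ℝ) ≤ L := le_trans (one_le_mul_of_one_le_of_one_le h1qR h1NR) hqNL
  -- the truncated function
  set F : ℤ → ℂ := fun n => if n ∈ Finset.Ioc (0 : ℤ) L then f n else 0 with hF
  have hF1 : ∀ n, ‖F n‖ ≤ 1 := by
    intro n
    simp only [hF]
    split_ifs
    · exact hf n
    · simp
  -- double counting: `∑_{n₀ ∈ [1-qN', L-q]} ∑_{t ∈ (0,N']} F(n₀+qt) = N' ∑_{(0,L]} f`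
  set R : Finset ℤ := Finset.Icc (1 - (q : ℤ) * N') (L - q) with hR
  have hdc : ∑ n₀ ∈ R, ∑ t ∈ Finset.Ioc (0 : ℤ) N', F (n₀ + q * t) =
      (N' : ℂ) * ∑ n ∈ Finset.Ioc (0 : ℤ) L, f n := by
    rw [Finset.sum_comm]
    have hinner : ∀ t ∈ Finset.Ioc (0 : ℤ) N', ∑ n₀ ∈ R, F (n₀ + q * t) =
        ∑ n ∈ Finset.Ioc (0 : ℤ) L, f n := by
      intro t ht
      rw [Finset.mem_Ioc] at ht
      -- translate `n₀ ↦ n₀ + qt`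
      have h1 : ∑ n₀ ∈ R, F (n₀ + q * t) =
          ∑ n ∈ Finset.Icc (1 - (q : ℤ) * N' + q * t) (L - q + q * t), F n := by
        rw [hR, ← Finset.map_add_right_Icc (c := (q : ℤ) * t)]
        rw [Finset.sum_map]
        rfl
      rw [h1]
      -- the big interval contains `(0, L]`, outside of which `F = 0`
      symm
      apply Finset.sum_subset_zero_on_sdiff
      · intro n hn
        rw [Finset.mem_Ioc] at hn
        rw [Finset.mem_Icc]
        have h1q : (1 : ℤ) ≤ q := by exact_mod_cast hq
        constructor <;> nlinarith
      · intro n hn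
        rw [Finset.mem_sdiff] at hn
        simp only [hF]
        rw [if_neg hn.2]
      · intro n hn
        simp only [hF]
        rw [if_pos hn]
    rw [Finset.sum_congr rfl hinner, Finset.sum_const, Int.card_Ioc, nsmul_eq_mul]
    simp
  -- split `R` into interior and boundary
  set Rin : Finset ℤ := Finset.Icc (0 : ℤ) (L - q * N') with hRin
  have hRin_sub : Rin ⊆ R := by
    intro n hn
    rw [hRin, Finset.mem_Icc] at hn
    rw [hR, Finset.mem_Icc]
    have h1q : (1 : ℤ) ≤ q := by exact_mod_cast hq
    have h1N : (1 : ℤ) ≤ N' := by exact_mod_cast hN'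
    constructor <;> nlinarith
  -- on the interior, `F(n₀ + qt) = f(n₀ + qt)` for all `t ∈ (0, N']`
  have hint : ∀ n₀ ∈ Rin, ∑ t ∈ Finset.Ioc (0 : ℤ) N', F (n₀ + q * t) =
      ∑ t ∈ Finset.Ioc (0 : ℤ) N', f (n₀ + q * t) := by
    intro n₀ hn₀
    rw [hRin, Finset.mem_Icc] at hn₀
    refine Finset.sum_congr rfl fun t ht => ?_
    rw [Finset.mem_Ioc] at ht
    simp only [hF]
    rw [if_pos]
    rw [Finset.mem_Ioc]
    have h1q : (1 : ℤ) ≤ q := by exact_mod_cast hq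
    constructor <;> nlinarith
  -- size of the boundary
  have hbd_card : (#(R \ Rin) : ℝ) ≤ 2 * q * N' := by
    have h1 : #(R \ Rin) = #R - #Rin := Finset.card_sdiff_of_subset hRin_sub
    have h1q : (1 : ℤ) ≤ q := by exact_mod_cast hq
    have h1N : (1 : ℤ) ≤ N' := by exact_mod_cast hN'
    have hR_card : (#R : ℤ) = L - q + q * N' := by
      rw [hR, Int.card_Icc, Int.toNat_of_nonneg (by nlinarith)]
      ring
    have hRin_card : (#Rin : ℤ) = L - q * N' + 1 := by
      rw [hRin, Int.card_Icc, Int.toNat_of_nonneg (by linarith)]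
      ring
    have h2 : ((#(R \ Rin) : ℕ) : ℤ) = (L - q + q * N') - (L - q * N' + 1) := by
      rw [h1, Nat.cast_sub (Finset.card_le_card hRin_sub), hR_card, hRin_card]
    have h3 : ((#(R \ Rin) : ℕ) : ℝ) = ((L : ℝ) - q + q * N') - (L - q * N' + 1) := by
      exact_mod_cast h2
    rw [h3]
    nlinarith
  -- the interior carries at least `N' δ L / 2`
  have hsplit : ∑ n₀ ∈ R, ∑ t ∈ Finset.Ioc (0 : ℤ) N', F (n₀ + q * t) =
      ∑ n₀ ∈ Rin, ∑ t ∈ Finset.Ioc (0 : ℤ) N', f (n₀ + q * t) +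
        ∑ n₀ ∈ R \ Rin, ∑ t ∈ Finset.Ioc (0 : ℤ) N', F (n₀ + q * t) := by
    rw [← Finset.sum_sdiff hRin_sub, add_comm, Finset.sum_congr rfl hint]
  have hbd_norm : ‖∑ n₀ ∈ R \ Rin, ∑ t ∈ Finset.Ioc (0 : ℤ) N', F (n₀ + q * t)‖ ≤
      2 * q * N' * N' := by
    refine (norm_sum_le _ _).trans ?_
    have h1 : ∀ n₀ ∈ R \ Rin, ‖∑ t ∈ Finset.Ioc (0 : ℤ) N', F (n₀ + q * t)‖ ≤ N' := by
      intro n₀ _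
      refine (norm_sum_le _ _).trans ?_
      calc ∑ t ∈ Finset.Ioc (0 : ℤ) N', ‖F (n₀ + q * t)‖ ≤ ∑ t ∈ Finset.Ioc (0 : ℤ) N', (1 : ℝ) :=
            Finset.sum_le_sum fun t _ => hF1 _
        _ = N' := by simp
    calc ∑ n₀ ∈ R \ Rin, ‖∑ t ∈ Finset.Ioc (0 : ℤ) N', F (n₀ + q * t)‖
        ≤ ∑ n₀ ∈ R \ Rin, (N' : ℝ) := Finset.sum_le_sum h1
      _ = #(R \ Rin) * N' := by rw [Finset.sum_const, nsmul_eq_mul]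
      _ ≤ 2 * q * N' * N' := by
          have := mul_le_mul_of_nonneg_right hbd_card hN'pos.le
          linarith
  have hin_norm : (N' : ℝ) * (δ * L) / 2 ≤
      ‖∑ n₀ ∈ Rin, ∑ t ∈ Finset.Ioc (0 : ℤ) N', f (n₀ + q * t)‖ := by
    have h1 : ‖(N' : ℂ) * ∑ n ∈ Finset.Ioc (0 : ℤ) L, f n‖ = N' * ‖∑ n ∈ Finset.Ioc (0 : ℤ) L, f n‖ := by
      rw [norm_mul, Complex.norm_natCast]
    have h2 : (N' : ℝ) * (δ * L) ≤ ‖∑ n₀ ∈ R, ∑ t ∈ Finset.Ioc (0 : ℤ) N', F (n₀ + q * t)‖ := by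
      rw [hdc, h1]
      exact mul_le_mul_of_nonneg_left hS hN'pos.le
    rw [hsplit] at h2
    have h3 := norm_add_le (∑ n₀ ∈ Rin, ∑ t ∈ Finset.Ioc (0 : ℤ) N', f (n₀ + q * t))
      (∑ n₀ ∈ R \ Rin, ∑ t ∈ Finset.Ioc (0 : ℤ) N', F (n₀ + q * t))
    have h4 : 2 * (q : ℝ) * N' * N' ≤ N' * (δ * L) / 2 := by nlinarith
    linarith
  -- pigeonhole over the `≤ L + 1` interior values of `n₀`
  have hRin_card_le : (#Rin : ℝ) ≤ L + 1 := by
    rw [hRin, Int.card_Icc]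
    have h1 : ((L - q * N' + 1 - 0 : ℤ).toNat : ℝ) ≤ (L : ℝ) + 1 := by
      have h1q : (0 : ℤ) ≤ q * N' := by positivity
      have h2 : (L - q * N' + 1 - 0 : ℤ).toNat ≤ L + 1 := by omega
      exact_mod_cast h2
    exact h1
  have hRin_ne : Rin.Nonempty := ⟨0, by
    rw [hRin, Finset.mem_Icc]
    exact ⟨le_rfl, by linarith⟩⟩
  obtain ⟨n₀, hn₀, hmax⟩ := Finset.exists_max_image Rin
    (fun n₀ => ‖∑ t ∈ Finset.Ioc (0 : ℤ) N', f (n₀ + q * t)‖) hRin_ne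
  have hn₀' := hn₀
  rw [hRin, Finset.mem_Icc] at hn₀'
  refine ⟨n₀, hn₀'.1, by linarith [hn₀'.2], ?_⟩
  -- the maximum is at least the average
  have havg : (N' : ℝ) * (δ * L) / 2 ≤ (L + 1) * ‖∑ t ∈ Finset.Ioc (0 : ℤ) N', f (n₀ + q * t)‖ := by
    refine hin_norm.trans ((norm_sum_le _ _).trans ?_)
    calc ∑ i ∈ Rin, ‖∑ t ∈ Finset.Ioc (0 : ℤ) N', f (i + q * t)‖
        ≤ ∑ i ∈ Rin, ‖∑ t ∈ Finset.Ioc (0 : ℤ) N', f (n₀ + q * t)‖ :=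
          Finset.sum_le_sum fun i hi => hmax i hi
      _ = #Rin * ‖∑ t ∈ Finset.Ioc (0 : ℤ) N', f (n₀ + q * t)‖ := by
          rw [Finset.sum_const, nsmul_eq_mul]
      _ ≤ (L + 1) * ‖∑ t ∈ Finset.Ioc (0 : ℤ) N', f (n₀ + q * t)‖ :=
          mul_le_mul_of_nonneg_right hRin_card_le (norm_nonneg _)
  -- `N' δ L/2 ≥ (L+1) δ N'/4` as `L ≥ 1`
  by_contra hcon
  rw [not_le] at hcon
  have h4 : (L + 1) * ‖∑ t ∈ Finset.Ioc (0 : ℤ) N', f (n₀ + q * t)‖ < (L + 1) * (δ * N' / 4) :=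
    mul_lt_mul_of_pos_left hcon (by positivity)
  have h5 : (N' : ℝ) * (δ * L) / 2 < (L + 1) * (δ * N' / 4) := lt_of_le_of_lt havg h4
  have h6 : 0 ≤ δ * N' * (L - 1) := mul_nonneg (mul_pos hδ hN'pos).le (by linarith)
  nlinarith

/-! ### Monotonicity of bounds of the shape `c u^a` -/

/-- If `X ≤ c u^a` with `0 ≤ c ≤ C'`, `a ≤ E`, `u ≥ 1`, then `X ≤ C' u^E`. [folklore] -/
theorem le_const_pow_of_le {X c C' u : ℝ} {a E : ℕ} (hX : X ≤ c * u ^ a) (hc0 : 0 ≤ c)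
    (hc : c ≤ C') (ha : a ≤ E) (hu : 1 ≤ u) : X ≤ C' * u ^ E :=
  hX.trans (mul_le_mul hc (pow_le_pow_right₀ hu ha) (by positivity) (hc0.trans hc))

/-- Division version of `le_const_pow_of_le`. [folklore] -/
theorem le_const_pow_div_of_le {X c C' u D : ℝ} {a E : ℕ} (hX : X ≤ c * u ^ a / D)
    (hc0 : 0 ≤ c) (hc : c ≤ C') (ha : a ≤ E) (hu : 1 ≤ u) (hD : 0 < D) :
    X ≤ C' * u ^ E / D :=
  hX.trans (div_le_div_of_nonneg_right (le_const_pow_of_le le_rfl hc0 hc ha hu) hD.le)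

/-! ### The perturbation on a progression -/

/-- `x^{i+1} - y^{i+1} ≤ (x - y)(i+1) x^i` for `0 ≤ y ≤ x`. [folklore] -/
theorem pow_succ_sub_pow_succ_le {x y : ℝ} (hy : 0 ≤ y) (hxy : y ≤ x) (i : ℕ) :
    x ^ (i + 1) - y ^ (i + 1) ≤ (x - y) * (i + 1) * x ^ i := by
  induction i with
  | zero => simp
  | succ i ih =>
    have hx : 0 ≤ x := hy.trans hxy
    have hyx : y ^ (i + 1) ≤ x ^ (i + 1) := pow_le_pow_left₀ hy hxy _
    have e : x ^ (i + 1 + 1) - y ^ (i + 1 + 1) =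
        x * (x ^ (i + 1) - y ^ (i + 1)) + y ^ (i + 1) * (x - y) := by ring
    rw [e]
    have h1 : x * (x ^ (i + 1) - y ^ (i + 1)) ≤ x * ((x - y) * (i + 1) * x ^ i) :=
      mul_le_mul_of_nonneg_left ih hx
    have h2 : y ^ (i + 1) * (x - y) ≤ x ^ (i + 1) * (x - y) :=
      mul_le_mul_of_nonneg_right hyx (by linarith)
    calc x * (x ^ (i + 1) - y ^ (i + 1)) + y ^ (i + 1) * (x - y)
        ≤ x * ((x - y) * (i + 1) * x ^ i) + x ^ (i + 1) * (x - y) := add_le_add h1 h2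
      _ = (x - y) * (↑(i + 1) + 1) * x ^ (i + 1) := by push_cast; ring

/-- **The tail is an integer plus a small error along a progression of step `q`.** Let
`deg p ≤ d`, `m ≤ d`, `q ≥ 1`, `0 ≤ n₀`, `0 < t ≤ N'`, `n₀ + qN' ≤ L`. Then
`(p - trunc_m p)(n₀ + qt) - (p - trunc_m p)(n₀)` differs from an integer by at most
`∑_{m<i≤d} ‖q p_i‖ · (N' i L^{i-1})` ((`n₀+qt)^i - n₀^i` is `q` times an integer of size
`≤ N' i L^{i-1}`). [cite: GreenTao2012Nilmanifolds, proof of Proposition 4.3 (variant in the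
monomial basis)] -/
theorem exists_int_near_tail_sub {p : ℝ[X]} {d m : ℕ} (hp : p.natDegree ≤ d) (hmd : m ≤ d)
    {q : ℕ} (hq : 1 ≤ q) {n₀ t : ℤ} (hn₀ : 0 ≤ n₀) (ht : 0 < t) {N' L : ℕ} (htN : t ≤ N')
    (hL : n₀ + q * N' ≤ L) :
    ∃ Z : ℤ, |(p - ∑ i ∈ Finset.range (m + 1), C (p.coeff i) * X ^ i).eval ((n₀ : ℝ) + q * t) -
        (p - ∑ i ∈ Finset.range (m + 1), C (p.coeff i) * X ^ i).eval (n₀ : ℝ) - Z| ≤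
      ∑ i ∈ Finset.Ioc m d, distInt (q * p.coeff i) * ((N' : ℝ) * i * (L : ℝ) ^ (i - 1)) := by
  -- `(n₀ + qt)^i - n₀^i = q Z_i`
  have hdvd : ∀ i : ℕ, ∃ Zi : ℤ, (n₀ + q * t) ^ i - n₀ ^ i = q * Zi := by
    intro i
    have h := sub_dvd_pow_sub_pow (n₀ + q * t) n₀ i
    rw [show n₀ + (q : ℤ) * t - n₀ = q * t by ring] at h
    exact (dvd_mul_right (q : ℤ) t).trans h
  choose Zf hZf using hdvd
  refine ⟨∑ i ∈ Finset.Ioc m d, round ((q : ℝ) * p.coeff i) * Zf i, ?_⟩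
  rw [eval_tail_sub hp hmd]
  -- termwise: `p_i (x^i - y^i) - round(q p_i) Z_i = (q p_i - round(q p_i)) Z_i`
  have hterm : ∀ i ∈ Finset.Ioc m d, p.coeff i * (((n₀ : ℝ) + q * t) ^ i - (n₀ : ℝ) ^ i) -
      ((round ((q : ℝ) * p.coeff i) : ℤ) : ℝ) * (Zf i : ℝ) =
        ((q : ℝ) * p.coeff i - round ((q : ℝ) * p.coeff i)) * (Zf i : ℝ) := by
    intro i _
    have h1 : ((n₀ : ℝ) + q * t) ^ i - (n₀ : ℝ) ^ i = (q : ℝ) * (Zf i : ℝ) := by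
      have := hZf i
      exact_mod_cast this
    rw [h1]
    ring
  push_cast
  rw [← Finset.sum_sub_distrib, Finset.sum_congr rfl hterm]
  refine (Finset.abs_sum_le_sum_abs _ _).trans (Finset.sum_le_sum fun i hi => ?_)
  rw [Finset.mem_Ioc] at hi
  rw [abs_mul]
  apply mul_le_mul (le_of_eq rfl) _ (abs_nonneg _) (distInt_nonneg _)
  -- `|Z_i| ≤ N' i L^{i-1}`: from `q |Z_i| = x^i - y^i ≤ (x - y) i x^{i-1} ≤ q N' i L^{i-1}`
  have hqR : (0 : ℝ) < q := by exact_mod_cast hq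
  have hx0 : (0 : ℝ) ≤ (n₀ : ℝ) := by exact_mod_cast hn₀
  have hxy : (n₀ : ℝ) ≤ (n₀ : ℝ) + q * t := by
    have : (0 : ℝ) < t := by exact_mod_cast ht
    nlinarith
  have hxL : (n₀ : ℝ) + q * t ≤ L := by
    have h1 : (t : ℝ) ≤ N' := by exact_mod_cast htN
    have h2 : ((n₀ + q * N' : ℤ) : ℝ) ≤ L := by exact_mod_cast hL
    push_cast at h2
    nlinarith
  obtain ⟨i', rfl⟩ : ∃ i', i = i' + 1 := ⟨i - 1, by omega⟩
  have hbound := pow_succ_sub_pow_succ_le hx0 hxy i'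
  rw [show (n₀ : ℝ) + q * t - n₀ = q * t by ring] at hbound
  have h1 : ((n₀ : ℝ) + q * t) ^ (i' + 1) - (n₀ : ℝ) ^ (i' + 1) = (q : ℝ) * (Zf (i' + 1) : ℝ) := by
    have := hZf (i' + 1)
    exact_mod_cast this
  rw [h1] at hbound
  -- `q |Z| = |q Z|` and `q Z ≥ 0`
  have hZnn : 0 ≤ (q : ℝ) * (Zf (i' + 1) : ℝ) := by
    rw [← h1]
    have := pow_le_pow_left₀ hx0 hxy (i' + 1)
    linarith
  have hZnn' : 0 ≤ (Zf (i' + 1) : ℝ) := by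
    rcases le_or_gt 0 (Zf (i' + 1) : ℝ) with h' | h'
    · exact h'
    · nlinarith
  rw [abs_of_nonneg hZnn', show i' + 1 - 1 = i' by omega]
  -- divide `hbound` by `q`
  have h2 : (q : ℝ) * (Zf (i' + 1) : ℝ) ≤ (q : ℝ) * ((N' : ℝ) * (↑(i' + 1) : ℝ) * (L : ℝ) ^ i') := by
    refine hbound.trans ?_
    have ht' : (t : ℝ) ≤ N' := by exact_mod_cast htN
    have hxpow : ((n₀ : ℝ) + q * t) ^ i' ≤ (L : ℝ) ^ i' :=
      pow_le_pow_left₀ (by linarith) hxL i'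
    have h3 : (q : ℝ) * t * (↑i' + 1) * ((n₀ : ℝ) + q * t) ^ i' ≤ (q : ℝ) * N' * (↑i' + 1) * (L : ℝ) ^ i' := by
      apply mul_le_mul _ hxpow (by positivity) (by positivity)
      apply mul_le_mul_of_nonneg_right _ (by positivity)
      exact mul_le_mul_of_nonneg_left ht' hqR.le
    refine h3.trans (le_of_eq ?_)
    push_cast
    ring
  exact le_of_mul_le_mul_left h2 hqR

/-- **The Weyl sum of `p` along a progression is the Weyl sum of its truncation, up to the
error of the tail.** With the notation and hypotheses of `exists_int_near_tail_sub`, if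
`∑_{m<i≤d} ‖q p_i‖ N' i L^{i-1} ≤ B` then
`‖∑_{0<t≤N'} e(p(n₀+qt))‖ ≤ ‖∑_{0<t≤N'} e(trunc_m p (n₀+qt))‖ + 2π B N'`.
[cite: GreenTao2012Nilmanifolds, proof of Proposition 4.3 (variant)] -/
theorem norm_sum_e_progression_le {p : ℝ[X]} {d m : ℕ} (hp : p.natDegree ≤ d) (hmd : m ≤ d)
    {q : ℕ} (hq : 1 ≤ q) {n₀ : ℤ} (hn₀ : 0 ≤ n₀) {N' L : ℕ} (hL : n₀ + q * N' ≤ L) {B : ℝ}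
    (hB : ∑ i ∈ Finset.Ioc m d, distInt (q * p.coeff i) * ((N' : ℝ) * i * (L : ℝ) ^ (i - 1)) ≤ B) :
    ‖∑ t ∈ Finset.Ioc (0 : ℤ) N', VdC.e (p.eval ((n₀ : ℝ) + q * t))‖ ≤
      ‖∑ t ∈ Finset.Ioc (0 : ℤ) N',
        VdC.e ((∑ i ∈ Finset.range (m + 1), C (p.coeff i) * X ^ i).eval ((n₀ : ℝ) + q * t))‖ +
      2 * Real.pi * B * N' := by
  set g : ℝ[X] := ∑ i ∈ Finset.range (m + 1), C (p.coeff i) * X ^ i with hg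
  set tailv : ℝ := (p - g).eval (n₀ : ℝ) with htailv
  -- per-`t` decomposition
  have hdec : ∀ t ∈ Finset.Ioc (0 : ℤ) N', ∃ E : ℝ, |E| ≤ B ∧
      VdC.e (p.eval ((n₀ : ℝ) + q * t)) = VdC.e tailv * VdC.e (g.eval ((n₀ : ℝ) + q * t) + E) := by
    intro t ht
    rw [Finset.mem_Ioc] at ht
    obtain ⟨Z, hZ⟩ := exists_int_near_tail_sub (m := m) hp hmd hq hn₀ ht.1 ht.2 hL
    set E : ℝ := (p - g).eval ((n₀ : ℝ) + q * t) - tailv - Z with hE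
    refine ⟨E, (le_of_eq (by rw [hE])).trans (hZ.trans hB), ?_⟩
    have h1 : p.eval ((n₀ : ℝ) + q * t) = tailv + (g.eval ((n₀ : ℝ) + q * t) + E) + (Z : ℝ) := by
      rw [hE, htailv, Polynomial.eval_sub, Polynomial.eval_sub]
      ring
    rw [h1, VdC.e_add_int, VdC.e_add]
  choose! Ef hEf using hdec
  have hsum : ∑ t ∈ Finset.Ioc (0 : ℤ) N', VdC.e (p.eval ((n₀ : ℝ) + q * t)) =
      VdC.e tailv * ∑ t ∈ Finset.Ioc (0 : ℤ) N', VdC.e (g.eval ((n₀ : ℝ) + q * t) + Ef t) := by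
    rw [Finset.mul_sum]
    exact Finset.sum_congr rfl fun t ht => (hEf t ht).2
  rw [hsum, norm_mul, VdC.norm_e, one_mul]
  -- compare with the unperturbed sum
  have hdiff : ‖∑ t ∈ Finset.Ioc (0 : ℤ) N', VdC.e (g.eval ((n₀ : ℝ) + q * t) + Ef t) -
      ∑ t ∈ Finset.Ioc (0 : ℤ) N', VdC.e (g.eval ((n₀ : ℝ) + q * t))‖ ≤ 2 * Real.pi * B * N' := by
    rw [← Finset.sum_sub_distrib]
    refine (norm_sum_le _ _).trans ?_
    calc ∑ t ∈ Finset.Ioc (0 : ℤ) N', ‖VdC.e (g.eval ((n₀ : ℝ) + q * t) + Ef t) -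
          VdC.e (g.eval ((n₀ : ℝ) + q * t))‖
        ≤ ∑ t ∈ Finset.Ioc (0 : ℤ) N', 2 * Real.pi * B := Finset.sum_le_sum fun t ht => by
          refine (norm_e_add_sub_e_le _ _).trans ?_
          exact mul_le_mul_of_nonneg_left (hEf t ht).1 (by positivity)
      _ = 2 * Real.pi * B * N' := by
          rw [Finset.sum_const, Int.card_Ioc, nsmul_eq_mul]
          simp
          ring
  have := norm_le_norm_add_norm_sub' (∑ t ∈ Finset.Ioc (0 : ℤ) N', VdC.e (g.eval ((n₀ : ℝ) + q * t) + Ef t))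
    (∑ t ∈ Finset.Ioc (0 : ℤ) N', VdC.e (g.eval ((n₀ : ℝ) + q * t)))
  linarith

/-! ### The descent step: parameters -/

/-- **Parameters of the descent step.** With `u = 8/δ² ≥ 8`, `C₁ ≥ 1`, `d ≥ 1`,
`1 ≤ q₁ ≤ C₁ u^{A₁}`, `W = 64 d² C₁ u^{A₁+1} q₁`, `N' = ⌊L/W⌋` and `L ≥ 128 d² C₁² u^{2A₁+1}`:
`N' ≥ 1`, `L ≤ 2 W N'`, `4 q₁ N' ≤ δ L` and `16π C₁ u^{A₁} d² N' ≤ δ L`. [folklore] -/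
theorem weyl_descend_params {δ u C₁ q₁ L W : ℝ} {A₁ d N' : ℕ} (hδ : 0 < δ) (hδ1 : δ ≤ 1)
    (hu : u = 8 / δ ^ 2) (hC₁ : 1 ≤ C₁) (hd : 1 ≤ d) (hq1 : 1 ≤ q₁) (hq : q₁ ≤ C₁ * u ^ A₁)
    (hW : W = 64 * (d : ℝ) ^ 2 * C₁ * u ^ (A₁ + 1) * q₁) (hN' : N' = ⌊L / W⌋₊)
    (hL : 128 * (d : ℝ) ^ 2 * C₁ ^ 2 * u ^ (2 * A₁ + 1) ≤ L) :
    1 ≤ N' ∧ L ≤ 2 * W * N' ∧ 4 * q₁ * N' ≤ δ * L ∧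
      16 * Real.pi * C₁ * u ^ A₁ * (d : ℝ) ^ 2 * N' ≤ δ * L := by
  have hδ2 : 0 < δ ^ 2 := by positivity
  have hu8 : 8 ≤ u := by rw [hu, le_div_iff₀ hδ2]; nlinarith
  have hu0 : 0 < u := by linarith
  have hdR : (1 : ℝ) ≤ d := by exact_mod_cast hd
  have hW0 : 0 < W := by rw [hW]; positivity
  have hL0 : 0 < L := lt_of_lt_of_le (by positivity) hL
  -- `W ≤ 64 d² C₁² u^{2A₁+1} ≤ L/2`
  have hWle : W ≤ 64 * (d : ℝ) ^ 2 * C₁ ^ 2 * u ^ (2 * A₁ + 1) := by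
    rw [hW]
    calc 64 * (d : ℝ) ^ 2 * C₁ * u ^ (A₁ + 1) * q₁ ≤ 64 * (d : ℝ) ^ 2 * C₁ * u ^ (A₁ + 1) * (C₁ * u ^ A₁) :=
          mul_le_mul_of_nonneg_left hq (by positivity)
      _ = 64 * (d : ℝ) ^ 2 * C₁ ^ 2 * u ^ (2 * A₁ + 1) := by
          rw [show 2 * A₁ + 1 = (A₁ + 1) + A₁ by ring, pow_add]; ring
  have hLW : 2 * W ≤ L := by linarith
  have hLW1 : 1 ≤ L / W := by rw [le_div_iff₀ hW0]; linarith
  have hN'1 : 1 ≤ N' := by rw [hN']; exact Nat.le_floor (by exact_mod_cast hLW1)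
  have hN'le : (N' : ℝ) ≤ L / W := by rw [hN']; exact Nat.floor_le (by positivity)
  have hN'ge : L / W ≤ 2 * N' := by
    have h1 : L / W < N' + 1 := by rw [hN']; exact Nat.lt_floor_add_one _
    have h2 : (1 : ℝ) ≤ N' := by exact_mod_cast hN'1
    linarith
  refine ⟨hN'1, ?_, ?_, ?_⟩
  · -- `L ≤ 2 W N'`
    have := mul_le_mul_of_nonneg_left hN'ge hW0.le
    rw [mul_div_cancel₀ _ hW0.ne'] at this
    linarith
  · -- `4 q₁ N' ≤ 4 q₁ L/W = L/(16 d² C₁ u^{A₁+1}) ≤ L/(16 u) ≤ δ L`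
    have h1 : 4 * q₁ * N' ≤ 4 * q₁ * (L / W) := mul_le_mul_of_nonneg_left hN'le (by positivity)
    have h2 : 4 * q₁ * (L / W) = L / (16 * (d : ℝ) ^ 2 * C₁ * u ^ (A₁ + 1)) := by
      rw [hW]; field_simp; ring
    have h3 : L / (16 * (d : ℝ) ^ 2 * C₁ * u ^ (A₁ + 1)) ≤ L / (16 * u) := by
      apply div_le_div_of_nonneg_left (by linarith) (by positivity)
      have : u ≤ (d : ℝ) ^ 2 * C₁ * u ^ (A₁ + 1) := by
        calc u = 1 * 1 * u ^ 1 := by ring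
          _ ≤ (d : ℝ) ^ 2 * C₁ * u ^ (A₁ + 1) := by
              apply mul_le_mul (mul_le_mul (by nlinarith) hC₁ zero_le_one (by positivity))
                (pow_le_pow_right₀ (by linarith) (by omega)) (by positivity) (by positivity)
      linarith
    have h4 : L / (16 * u) ≤ δ * L := by
      rw [div_le_iff₀ (by positivity)]
      -- `1 ≤ 16 u δ = 128/δ`
      have : 1 ≤ 16 * u * δ := by
        rw [hu]
        have : 16 * (8 / δ ^ 2) * δ = 128 / δ := by field_simp; ring
        rw [this, le_div_iff₀ hδ]
        linarith
      nlinarith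
    linarith
  · -- `16 π C₁ u^{A₁} d² N' ≤ 16π C₁ u^{A₁} d² L/W = π L/(4 u q₁) ≤ π L /(4u) ≤ δ L`
    have h1 : 16 * Real.pi * C₁ * u ^ A₁ * (d : ℝ) ^ 2 * N' ≤
        16 * Real.pi * C₁ * u ^ A₁ * (d : ℝ) ^ 2 * (L / W) :=
      mul_le_mul_of_nonneg_left hN'le (by positivity)
    have h2 : 16 * Real.pi * C₁ * u ^ A₁ * (d : ℝ) ^ 2 * (L / W) = Real.pi * L / (4 * u * q₁) := by
      rw [hW, pow_succ]; field_simp; ring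
    have h3 : Real.pi * L / (4 * u * q₁) ≤ Real.pi * L / (4 * u) := by
      apply div_le_div_of_nonneg_left (mul_nonneg Real.pi_pos.le hL0.le) (by positivity)
      nlinarith
    have h4 : Real.pi * L / (4 * u) ≤ δ * L := by
      rw [div_le_iff₀ (by positivity)]
      have hπ := Real.pi_lt_four
      -- `π ≤ 4 u δ = 32/δ`
      have : Real.pi ≤ 4 * u * δ := by
        rw [hu]
        have : 4 * (8 / δ ^ 2) * δ = 32 / δ := by field_simp; ring
        rw [this, le_div_iff₀ hδ]
        nlinarith
      nlinarith
    linarith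

/-! ### The descent step: bookkeeping of constants -/

section DescentConstants

variable {d m A₁ A₂ : ℕ} {u C₁ C₂ M : ℝ}

/-- `C₁ ≤ M = 128 d² C₁²` and `1 ≤ M` for `C₁, d ≥ 1`. [folklore] -/
theorem descent_M_facts (hC₁ : 1 ≤ C₁) (hd : 1 ≤ d) (hM : M = 128 * (d : ℝ) ^ 2 * C₁ ^ 2) :
    1 ≤ M ∧ C₁ ≤ M := by
  have hdR : (1 : ℝ) ≤ d := by exact_mod_cast hd
  have h2 : (1 : ℝ) ≤ (d : ℝ) ^ 2 := one_le_pow₀ hdR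
  have h1 : C₁ ≤ C₁ ^ 2 := by nlinarith
  have hC : C₁ ≤ M := by
    rw [hM]
    calc C₁ = 1 * C₁ := (one_mul _).symm
      _ ≤ (d : ℝ) ^ 2 * C₁ ^ 2 := mul_le_mul h2 h1 (by linarith) (by positivity)
      _ ≤ 128 * (d : ℝ) ^ 2 * C₁ ^ 2 := by
          nlinarith [mul_nonneg (le_trans zero_le_one h2) (sq_nonneg C₁)]
  exact ⟨le_trans hC₁ hC, hC⟩

/-- Size of the new denominator: `q₁ k q₁^m ≤ C' u^E`. [folklore] -/
theorem descent_bound_size (hC₁ : 1 ≤ C₁) (hd : 1 ≤ d) (hmd : m < d) (hu1 : 1 ≤ u)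
    (hM : M = 128 * (d : ℝ) ^ 2 * C₁ ^ 2) {q₁ k : ℝ} (hq0 : 0 ≤ q₁) (hq : q₁ ≤ C₁ * u ^ A₁)
    (hk0 : 0 ≤ k) (hk : k ≤ C₂ * (64 * u) ^ A₂) :
    q₁ * (k * q₁ ^ m) ≤ C₂ * 64 ^ A₂ * M ^ (2 * d + 1) * u ^ (A₁ + A₂ + (2 * A₁ + 1) * d + A₁ * d) := by
  obtain ⟨hM1, hMC⟩ := descent_M_facts hC₁ hd hM
  have hC₁0 : 0 ≤ C₁ := by linarith
  have hC₂0 : 0 ≤ C₂ := le_trans (by positivity) (le_trans hk0 hk) |> fun h => by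
    rcases le_or_gt 0 C₂ with h' | h'
    · exact h'
    · have : C₂ * (64 * u) ^ A₂ < 0 := mul_neg_of_neg_of_pos h' (by positivity)
      linarith
  have h1 : q₁ * (k * q₁ ^ m) ≤ (C₁ * u ^ A₁) * ((C₂ * (64 * u) ^ A₂) * (C₁ * u ^ A₁) ^ m) :=
    mul_le_mul hq (mul_le_mul hk (pow_le_pow_left₀ hq0 hq m) (by positivity) (by positivity))
      (by positivity) (by positivity)
  have h2 : (C₁ * u ^ A₁) * ((C₂ * (64 * u) ^ A₂) * (C₁ * u ^ A₁) ^ m) =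
      (C₂ * 64 ^ A₂ * C₁ ^ (m + 1)) * u ^ (A₂ + A₁ * m + A₁) := by
    rw [mul_pow, mul_pow, ← pow_mul, pow_add, pow_add, pow_succ]
    ring
  rw [h2] at h1
  refine le_const_pow_of_le h1 (by positivity) ?_ (by nlinarith) hu1
  calc C₂ * 64 ^ A₂ * C₁ ^ (m + 1) ≤ C₂ * 64 ^ A₂ * M ^ (m + 1) :=
        mul_le_mul_of_nonneg_left (pow_le_pow_left₀ hC₁0 hMC _) (by positivity)
    _ ≤ C₂ * 64 ^ A₂ * M ^ (2 * d + 1) :=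
        mul_le_mul_of_nonneg_left (pow_le_pow_right₀ hM1 (by omega)) (by positivity)

/-- The bound for the coefficients above `m`: `k q₁^m · C₁ u^{A₁}/L^i ≤ C' u^E / L^i`.
[folklore] -/
theorem descent_bound_high (hC₁ : 1 ≤ C₁) (hd : 1 ≤ d) (hmd : m < d) (hu1 : 1 ≤ u)
    (hM : M = 128 * (d : ℝ) ^ 2 * C₁ ^ 2) {q₁ k L : ℝ} (hL : 0 < L) (hq0 : 0 ≤ q₁)
    (hq : q₁ ≤ C₁ * u ^ A₁) (hk0 : 0 ≤ k) (hk : k ≤ C₂ * (64 * u) ^ A₂) (i : ℕ) :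
    (k * q₁ ^ m) * (C₁ * u ^ A₁ / L ^ i) ≤
      C₂ * 64 ^ A₂ * M ^ (2 * d + 1) * u ^ (A₁ + A₂ + (2 * A₁ + 1) * d + A₁ * d) / L ^ i := by
  obtain ⟨hM1, hMC⟩ := descent_M_facts hC₁ hd hM
  have hC₁0 : 0 ≤ C₁ := by linarith
  have h1 : (k * q₁ ^ m) * (C₁ * u ^ A₁ / L ^ i) ≤
      ((C₂ * (64 * u) ^ A₂) * (C₁ * u ^ A₁) ^ m) * (C₁ * u ^ A₁ / L ^ i) := by
    apply mul_le_mul_of_nonneg_right _ (by positivity)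
    exact mul_le_mul hk (pow_le_pow_left₀ hq0 hq m) (by positivity)
      (le_trans hk0 hk)
  have h2 : ((C₂ * (64 * u) ^ A₂) * (C₁ * u ^ A₁) ^ m) * (C₁ * u ^ A₁ / L ^ i) =
      (C₂ * 64 ^ A₂ * C₁ ^ (m + 1)) * u ^ (A₂ + A₁ * m + A₁) / L ^ i := by
    rw [mul_pow, mul_pow, ← pow_mul, pow_add, pow_add, pow_succ]
    ring
  rw [h2] at h1
  have hC₂0 : 0 ≤ C₂ := by
    rcases le_or_gt 0 C₂ with h' | h'
    · exact h'
    · have : C₂ * (64 * u) ^ A₂ < 0 := mul_neg_of_neg_of_pos h' (by positivity)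
      linarith
  refine le_const_pow_div_of_le h1 (by positivity) ?_ (by nlinarith) hu1 (by positivity)
  calc C₂ * 64 ^ A₂ * C₁ ^ (m + 1) ≤ C₂ * 64 ^ A₂ * M ^ (m + 1) :=
        mul_le_mul_of_nonneg_left (pow_le_pow_left₀ hC₁0 hMC _) (by positivity)
    _ ≤ C₂ * 64 ^ A₂ * M ^ (2 * d + 1) :=
        mul_le_mul_of_nonneg_left (pow_le_pow_right₀ hM1 (by omega)) (by positivity)

/-- The bound for the coefficient `m`: `q₁ · C₂ (64u)^{A₂}/N'^m ≤ C' u^E / L^m` when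
`L ≤ 2 W N'` and `2 W ≤ M u^{2A₁+1}`. [folklore] -/
theorem descent_bound_top (hC₁ : 1 ≤ C₁) (hC₂ : 0 ≤ C₂) (hd : 1 ≤ d) (hmd : m < d) (hu1 : 1 ≤ u)
    (hM : M = 128 * (d : ℝ) ^ 2 * C₁ ^ 2) {q₁ L W N' : ℝ} (hL : 0 < L) (hN' : 0 < N') (hW : 0 ≤ W)
    (hq0 : 0 ≤ q₁) (hq : q₁ ≤ C₁ * u ^ A₁) (hL2WN : L ≤ 2 * W * N')
    (h2W : 2 * W ≤ M * u ^ (2 * A₁ + 1)) :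
    q₁ * (C₂ * (64 * u) ^ A₂ / N' ^ m) ≤
      C₂ * 64 ^ A₂ * M ^ (2 * d + 1) * u ^ (A₁ + A₂ + (2 * A₁ + 1) * d + A₁ * d) / L ^ m := by
  obtain ⟨hM1, hMC⟩ := descent_M_facts hC₁ hd hM
  have h2 : L ^ m ≤ (2 * W) ^ m * N' ^ m := by
    rw [← mul_pow]; exact pow_le_pow_left₀ hL.le (by linarith) m
  have h3 : C₂ * (64 * u) ^ A₂ / N' ^ m ≤ C₂ * (64 * u) ^ A₂ * (2 * W) ^ m / L ^ m := by
    rw [div_le_div_iff₀ (by positivity) (by positivity)]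
    calc C₂ * (64 * u) ^ A₂ * L ^ m ≤ C₂ * (64 * u) ^ A₂ * ((2 * W) ^ m * N' ^ m) :=
          mul_le_mul_of_nonneg_left h2 (by positivity)
      _ = C₂ * (64 * u) ^ A₂ * (2 * W) ^ m * N' ^ m := by ring
  have h4 : q₁ * (C₂ * (64 * u) ^ A₂ / N' ^ m) ≤ q₁ * (C₂ * (64 * u) ^ A₂ * (2 * W) ^ m / L ^ m) :=
    mul_le_mul_of_nonneg_left h3 hq0
  refine h4.trans ?_
  have h5 : q₁ * (C₂ * (64 * u) ^ A₂ * (2 * W) ^ m / L ^ m) ≤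
      (C₁ * u ^ A₁) * (C₂ * (64 * u) ^ A₂ * (M * u ^ (2 * A₁ + 1)) ^ m / L ^ m) := by
    apply mul_le_mul hq _ (by positivity) (by positivity)
    apply div_le_div_of_nonneg_right _ (by positivity)
    apply mul_le_mul_of_nonneg_left _ (by positivity)
    exact pow_le_pow_left₀ (by positivity) h2W m
  refine h5.trans ?_
  have h6 : (C₁ * u ^ A₁) * (C₂ * (64 * u) ^ A₂ * (M * u ^ (2 * A₁ + 1)) ^ m / L ^ m) =
      (C₁ * C₂ * 64 ^ A₂ * M ^ m) * u ^ (A₁ + A₂ + (2 * A₁ + 1) * m) / L ^ m := by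
    rw [mul_pow, mul_pow, ← pow_mul, pow_add, pow_add]
    ring
  rw [h6]
  refine le_const_pow_div_of_le le_rfl (by positivity) ?_ (by nlinarith) hu1 (by positivity)
  calc C₁ * C₂ * 64 ^ A₂ * M ^ m = C₂ * 64 ^ A₂ * (C₁ * M ^ m) := by ring
    _ ≤ C₂ * 64 ^ A₂ * (M * M ^ m) :=
        mul_le_mul_of_nonneg_left (mul_le_mul_of_nonneg_right hMC (by positivity)) (by positivity)
    _ = C₂ * 64 ^ A₂ * M ^ (m + 1) := by rw [pow_succ]; ring
    _ ≤ C₂ * 64 ^ A₂ * M ^ (2 * d + 1) :=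
        mul_le_mul_of_nonneg_left (pow_le_pow_right₀ hM1 (by omega)) (by positivity)

/-- The small-`L` case of the descent: if `1 ≤ L < M u^{2A₁+1}` then `1 ≤ C' u^E` and
`1/2 ≤ C' u^E / L^i` for all `i ≤ d`. [folklore] -/
theorem descent_small (hC₁ : 1 ≤ C₁) (hC₂ : 1 ≤ C₂) (hd : 1 ≤ d) (hu1 : 1 ≤ u)
    (hM : M = 128 * (d : ℝ) ^ 2 * C₁ ^ 2) {L : ℝ} (hL1 : 1 ≤ L)
    (hsmall : L < M * u ^ (2 * A₁ + 1)) {i : ℕ} (hid : i ≤ d) :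
    (1 : ℝ) ≤ C₂ * 64 ^ A₂ * M ^ (2 * d + 1) * u ^ (A₁ + A₂ + (2 * A₁ + 1) * d + A₁ * d) ∧
      1 / 2 ≤ C₂ * 64 ^ A₂ * M ^ (2 * d + 1) * u ^ (A₁ + A₂ + (2 * A₁ + 1) * d + A₁ * d) / L ^ i := by
  obtain ⟨hM1, hMC⟩ := descent_M_facts hC₁ hd hM
  have hLpos : 0 < L := by linarith
  have h64 : (1 : ℝ) ≤ 64 ^ A₂ := one_le_pow₀ (by norm_num)
  set C' : ℝ := C₂ * 64 ^ A₂ * M ^ (2 * d + 1) with hC'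
  set E : ℕ := A₁ + A₂ + (2 * A₁ + 1) * d + A₁ * d with hE
  have hC'1 : 1 ≤ C' := by
    rw [hC']
    calc (1 : ℝ) = 1 * 1 * 1 := by ring
      _ ≤ C₂ * 64 ^ A₂ * M ^ (2 * d + 1) :=
          mul_le_mul (mul_le_mul hC₂ h64 zero_le_one (by positivity)) (one_le_pow₀ hM1)
            zero_le_one (by positivity)
  have huE : 1 ≤ u ^ E := one_le_pow₀ hu1
  constructor
  · nlinarith
  · rw [le_div_iff₀ (by positivity)]
    have h1 : L ^ i ≤ L ^ d := pow_le_pow_right₀ hL1 hid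
    have h2 : L ^ d ≤ (M * u ^ (2 * A₁ + 1)) ^ d := pow_le_pow_left₀ hLpos.le hsmall.le d
    have h3 : (M * u ^ (2 * A₁ + 1)) ^ d = M ^ d * u ^ ((2 * A₁ + 1) * d) := by
      rw [mul_pow, ← pow_mul]
    have h5 : M ^ d ≤ 2 * C' := by
      rw [hC']
      calc M ^ d = 1 * 1 * M ^ d := by ring
        _ ≤ (2 * C₂) * 64 ^ A₂ * M ^ (2 * d + 1) :=
            mul_le_mul (mul_le_mul (by linarith) h64 zero_le_one (by positivity))
              (pow_le_pow_right₀ hM1 (by omega)) (by positivity) (by positivity)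
        _ = 2 * (C₂ * 64 ^ A₂ * M ^ (2 * d + 1)) := by ring
    have h4 : M ^ d * u ^ ((2 * A₁ + 1) * d) ≤ 2 * (C' * u ^ E) := by
      calc M ^ d * u ^ ((2 * A₁ + 1) * d) ≤ (2 * C') * u ^ E :=
            mul_le_mul h5 (pow_le_pow_right₀ hu1 (by rw [hE]; nlinarith)) (by positivity)
              (by positivity)
        _ = 2 * (C' * u ^ E) := by ring
    calc 1 / 2 * L ^ i ≤ 1 / 2 * (M ^ d * u ^ ((2 * A₁ + 1) * d)) := by
          rw [← h3]; exact mul_le_mul_of_nonneg_left (h1.trans h2) (by norm_num)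
      _ ≤ 1 / 2 * (2 * (C' * u ^ E)) := mul_le_mul_of_nonneg_left h4 (by norm_num)
      _ = C' * u ^ E := by ring

end DescentConstants

/-- The error budget of the tail along a progression of step `q₁`: if `‖q₁ p_i‖ ≤ C₁u^{A₁}/L^i`
for `m < i ≤ d` then `∑_{m<i≤d} ‖q₁ p_i‖ N' i L^{i-1} ≤ C₁ u^{A₁} d² N'/L`. [folklore] -/
theorem descent_error_budget {p : ℝ[X]} {d m : ℕ} {q₁ N' L : ℕ} (hL : 1 ≤ L) {C₁ u : ℝ} {A₁ : ℕ}
    (hC : 0 ≤ C₁ * u ^ A₁)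
    (hq₁dist : ∀ i, m < i → i ≤ d → distInt (q₁ * p.coeff i) ≤ C₁ * u ^ A₁ / (L : ℝ) ^ i) :
    ∑ i ∈ Finset.Ioc m d, distInt (q₁ * p.coeff i) * ((N' : ℝ) * i * (L : ℝ) ^ (i - 1)) ≤
      C₁ * u ^ A₁ * (d : ℝ) ^ 2 * N' / L := by
  have hLpos : (0 : ℝ) < L := by exact_mod_cast hL
  calc ∑ i ∈ Finset.Ioc m d, distInt (q₁ * p.coeff i) * ((N' : ℝ) * i * (L : ℝ) ^ (i - 1))
      ≤ ∑ i ∈ Finset.Ioc m d, (C₁ * u ^ A₁ / (L : ℝ) ^ i) * ((N' : ℝ) * i * (L : ℝ) ^ (i - 1)) :=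
        Finset.sum_le_sum fun i hi => by
          rw [Finset.mem_Ioc] at hi
          exact mul_le_mul_of_nonneg_right (hq₁dist i hi.1 hi.2) (by positivity)
    _ = ∑ i ∈ Finset.Ioc m d, C₁ * u ^ A₁ * N' / L * i := by
        refine Finset.sum_congr rfl fun i hi => ?_
        rw [Finset.mem_Ioc] at hi
        have hLi : (L : ℝ) ^ i = (L : ℝ) ^ (i - 1) * L := by
          rw [← pow_succ, Nat.sub_add_cancel (by omega)]
        rw [hLi]
        field_simp
    _ = C₁ * u ^ A₁ * N' / L * ∑ i ∈ Finset.Ioc m d, (i : ℝ) := by rw [Finset.mul_sum]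
    _ ≤ C₁ * u ^ A₁ * N' / L * (d : ℝ) ^ 2 := by
        apply mul_le_mul_of_nonneg_left _ (by positivity)
        calc ∑ i ∈ Finset.Ioc m d, (i : ℝ) ≤ ∑ i ∈ Finset.Ioc m d, (d : ℝ) :=
              Finset.sum_le_sum fun i hi => by
                rw [Finset.mem_Ioc] at hi; exact_mod_cast hi.2
          _ = #(Finset.Ioc m d) * (d : ℝ) := by rw [Finset.sum_const, nsmul_eq_mul]
          _ ≤ d * d := by
              apply mul_le_mul_of_nonneg_right _ (by positivity)
              rw [Nat.card_Ioc]; exact_mod_cast Nat.sub_le d m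
          _ = (d : ℝ) ^ 2 := by ring
    _ = C₁ * u ^ A₁ * (d : ℝ) ^ 2 * N' / L := by ring

/-! ### The descent step -/

/-- **Green–Tao 2012, proof of Proposition 4.3 (one descent step), monomial-basis variant.**
Suppose Weyl's estimate is known (a) for the coefficients of `X^i`, `m < i ≤ d`, of degree-`≤ d`
phases on `(0, L]` (constants `A₁, C₁`) and (b) for the top coefficient of degree-`≤ m` phases on
arbitrary intervals (constants `A₂, C₂`; `weyl_topCoeff m`). Then it holds for the coefficients
`m ≤ i ≤ d` on `(0, L]`, with constants `(E, C')`,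
`E = A₁ + A₂ + (2A₁+1)d + A₁ d`, `C' = C₂ 64^{A₂} (128 d² C₁²)^{2d+1}`: split `(0, L]` into
progressions of step `q₁` (the denominator from (a)) and length `N' ≈ L/(64 d² C₁ u^{A₁+1} q₁)`,
along which the tail `∑_{i>m} p_i n^i` is an integer plus `O(δ)` (`exists_int_near_tail_sub`),
find a progression with a large Weyl sum (`exists_progression_large`), and apply (b) to the
truncation reparametrised along it (`exists_affineComp`), whose top coefficient is `q₁^m p_m`.
[cite: GreenTao2012Nilmanifolds, Proposition 4.3 (proof, inductive step)] -/
theorem weyl_descend {d m : ℕ} (hmd : m < d) {A₁ : ℕ} {C₁ : ℝ} (hC₁ : 1 ≤ C₁)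
    (hUP : ∀ (δ : ℝ) (L : ℕ) (p : ℝ[X]), 0 < δ → δ ≤ 1 → p.natDegree ≤ d → 1 ≤ L →
        δ * L ≤ ‖∑ n ∈ Finset.Ioc (0 : ℤ) L, VdC.e (p.eval (n : ℝ))‖ →
        ∃ q : ℕ, 1 ≤ q ∧ (q : ℝ) ≤ C₁ * (8 / δ ^ 2) ^ A₁ ∧
          ∀ i, m < i → i ≤ d → distInt (q * p.coeff i) ≤ C₁ * (8 / δ ^ 2) ^ A₁ / (L : ℝ) ^ i)
    {A₂ : ℕ} {C₂ : ℝ} (hC₂ : 1 ≤ C₂)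
    (hTOP : ∀ (δ : ℝ) (a : ℤ) (L : ℕ) (p : ℝ[X]), 0 < δ → δ ≤ 1 → p.natDegree ≤ m → 1 ≤ L →
        δ * L ≤ ‖∑ n ∈ Finset.Ioc a (a + L), VdC.e (p.eval (n : ℝ))‖ →
        ∃ k : ℕ, 1 ≤ k ∧ (k : ℝ) ≤ C₂ * (8 / δ ^ 2) ^ A₂ ∧
          distInt (k * p.coeff m) ≤ C₂ * (8 / δ ^ 2) ^ A₂ / (L : ℝ) ^ m)
    {δ : ℝ} (hδ : 0 < δ) (hδ1 : δ ≤ 1) {L : ℕ} (hL : 1 ≤ L) {p : ℝ[X]} (hp : p.natDegree ≤ d)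
    (hS : δ * L ≤ ‖∑ n ∈ Finset.Ioc (0 : ℤ) L, VdC.e (p.eval (n : ℝ))‖) :
    ∃ q : ℕ, 1 ≤ q ∧
      (q : ℝ) ≤ C₂ * 64 ^ A₂ * (128 * (d : ℝ) ^ 2 * C₁ ^ 2) ^ (2 * d + 1) *
        (8 / δ ^ 2) ^ (A₁ + A₂ + (2 * A₁ + 1) * d + A₁ * d) ∧
      ∀ i, m ≤ i → i ≤ d → distInt (q * p.coeff i) ≤
        C₂ * 64 ^ A₂ * (128 * (d : ℝ) ^ 2 * C₁ ^ 2) ^ (2 * d + 1) *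
          (8 / δ ^ 2) ^ (A₁ + A₂ + (2 * A₁ + 1) * d + A₁ * d) / (L : ℝ) ^ i := by
  classical
  have hδ2 : 0 < δ ^ 2 := by positivity
  set u : ℝ := 8 / δ ^ 2 with hu
  have hu8 : 8 ≤ u := by rw [hu, le_div_iff₀ hδ2]; nlinarith
  have hu1 : 1 ≤ u := by linarith
  have hd1 : 1 ≤ d := by omega
  have hC₁0 : 0 < C₁ := by linarith
  have hLpos : (0 : ℝ) < L := by exact_mod_cast hL
  have hL1 : (1 : ℝ) ≤ L := by exact_mod_cast hL
  set M : ℝ := 128 * (d : ℝ) ^ 2 * C₁ ^ 2 with hM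
  /- the small case `L < M u^{2A₁+1}` -/
  rcases lt_or_ge (L : ℝ) (M * u ^ (2 * A₁ + 1)) with hsmall | hlarge
  · refine ⟨1, le_rfl, ?_, fun i _ hid => ?_⟩
    · rw [Nat.cast_one]
      exact (descent_small (A₂ := A₂) hC₁ hC₂ hd1 hu1 hM hL1 hsmall le_rfl).1
    · rw [Nat.cast_one, one_mul]
      exact (distInt_le_half _).trans (descent_small hC₁ hC₂ hd1 hu1 hM hL1 hsmall hid).2
  /- the main case -/
  obtain ⟨q₁, hq₁1, hq₁le, hq₁dist⟩ := hUP δ L p hδ hδ1 hp hL hS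
  have hq₁R : (1 : ℝ) ≤ q₁ := by exact_mod_cast hq₁1
  set W : ℝ := 64 * (d : ℝ) ^ 2 * C₁ * u ^ (A₁ + 1) * q₁ with hW
  set N' : ℕ := ⌊(L : ℝ) / W⌋₊ with hN'
  have hlarge' : 128 * (d : ℝ) ^ 2 * C₁ ^ 2 * u ^ (2 * A₁ + 1) ≤ L := by rw [hM] at hlarge; exact hlarge
  obtain ⟨hN'1, hL2WN, h4qN, herrN⟩ :=
    weyl_descend_params hδ hδ1 hu hC₁ hd1 hq₁R hq₁le hW hN' hlarge'
  have hN'pos : (0 : ℝ) < N' := by exact_mod_cast hN'1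
  have hW0 : 0 < W := by rw [hW]; positivity
  -- Step 1: a progression of step `q₁` with a large Weyl sum
  obtain ⟨n₀, hn₀0, hn₀L, hprog⟩ := exists_progression_large (f := fun n : ℤ => VdC.e (p.eval (n : ℝ)))
    (fun n => (VdC.norm_e _).le) hq₁1 hN'1 hδ h4qN hS
  push_cast at hprog
  -- Step 2: replace `p` by its truncation `g`
  set g : ℝ[X] := ∑ i ∈ Finset.range (m + 1), C (p.coeff i) * X ^ i with hg
  have hB := descent_error_budget (p := p) (m := m) (q₁ := q₁) (N' := N') hL
    (by positivity : 0 ≤ C₁ * u ^ A₁) hq₁dist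
  have hpert := norm_sum_e_progression_le (m := m) hp hmd.le hq₁1 hn₀0 hn₀L hB
  have herr : 2 * Real.pi * (C₁ * u ^ A₁ * (d : ℝ) ^ 2 * N' / L) * N' ≤ δ * N' / 8 := by
    have h1 : 2 * Real.pi * (C₁ * u ^ A₁ * (d : ℝ) ^ 2 * N' / L) * N' =
        (16 * Real.pi * C₁ * u ^ A₁ * (d : ℝ) ^ 2 * N') * N' / (8 * L) := by
      field_simp; ring
    rw [h1, div_le_iff₀ (by positivity)]
    have := mul_le_mul_of_nonneg_right herrN hN'pos.le
    nlinarith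
  have hgsum : δ / 8 * N' ≤ ‖∑ t ∈ Finset.Ioc (0 : ℤ) N', VdC.e (g.eval ((n₀ : ℝ) + q₁ * t))‖ := by
    have := hprog.trans hpert
    linarith
  -- Step 3: reparametrise and apply the top-coefficient estimate in degree `m`
  have hgdeg : g.natDegree ≤ m := natDegree_trunc_le p m
  have hgm : g.coeff m = p.coeff m := by rw [hg, coeff_trunc]; simp
  obtain ⟨P, hPdeg, hPm, hPev⟩ := exists_affineComp hgdeg (n₀ : ℝ) (q₁ : ℝ)
  have hsumP : ∑ t ∈ Finset.Ioc (0 : ℤ) N', VdC.e (g.eval ((n₀ : ℝ) + q₁ * t)) =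
      ∑ t ∈ Finset.Ioc (0 : ℤ) (0 + N'), VdC.e (P.eval (t : ℝ)) := by
    rw [zero_add]
    exact Finset.sum_congr rfl fun t _ => by rw [hPev]
  rw [hsumP] at hgsum
  have hδ8 : 0 < δ / 8 := by positivity
  have hδ81 : δ / 8 ≤ 1 := by linarith
  obtain ⟨k, hk1, hkle, hkdist⟩ := hTOP (δ / 8) 0 N' P hδ8 hδ81 hPdeg hN'1 hgsum
  have hu64 : 8 / (δ / 8) ^ 2 = 64 * u := by rw [hu]; field_simp; ring
  rw [hu64] at hkle hkdist
  rw [hPm, hgm] at hkdist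
  have hq₁0 : (0 : ℝ) ≤ q₁ := by positivity
  have hk0 : (0 : ℝ) ≤ k := by positivity
  have hC₂0 : 0 ≤ C₂ := by linarith
  -- `2W ≤ M u^{2A₁+1}`
  have h2W : 2 * W ≤ M * u ^ (2 * A₁ + 1) := by
    rw [hW, hM]
    calc 2 * (64 * (d : ℝ) ^ 2 * C₁ * u ^ (A₁ + 1) * q₁)
        ≤ 2 * (64 * (d : ℝ) ^ 2 * C₁ * u ^ (A₁ + 1) * (C₁ * u ^ A₁)) := by
          apply mul_le_mul_of_nonneg_left _ (by norm_num)
          exact mul_le_mul_of_nonneg_left hq₁le (by positivity)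
      _ = 128 * (d : ℝ) ^ 2 * C₁ ^ 2 * u ^ (2 * A₁ + 1) := by
          rw [show 2 * A₁ + 1 = (A₁ + 1) + A₁ by ring, pow_add]; ring
  -- Step 4: the new denominator `q₁ · (k q₁^m)`
  refine ⟨q₁ * (k * q₁ ^ m), Nat.mul_pos hq₁1 (Nat.mul_pos hk1 (pow_pos hq₁1 m)), ?_, ?_⟩
  · push_cast
    exact descent_bound_size hC₁ hd1 hmd hu1 hM hq₁0 hq₁le hk0 hkle
  · intro i hmi hid
    rcases hmi.eq_or_lt with hmeq | hmlt
    · subst hmeq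
      have e : ((q₁ * (k * q₁ ^ m) : ℕ) : ℝ) * p.coeff m = q₁ * (k * ((q₁ : ℝ) ^ m * p.coeff m)) := by
        push_cast; ring
      rw [e]
      refine (distInt_natMul_le q₁ _).trans ?_
      refine (mul_le_mul_of_nonneg_left hkdist hq₁0).trans ?_
      exact descent_bound_top hC₁ hC₂0 hd1 hmd hu1 hM hLpos hN'pos hW0.le hq₁0 hq₁le hL2WN h2W
    · have e : ((q₁ * (k * q₁ ^ m) : ℕ) : ℝ) * p.coeff i = ((k * q₁ ^ m : ℕ) : ℝ) * ((q₁ : ℝ) * p.coeff i) := by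
        push_cast; ring
      rw [e]
      refine (distInt_natMul_le _ _).trans ?_
      refine (mul_le_mul_of_nonneg_left (hq₁dist i hmlt hid) (by positivity)).trans ?_
      push_cast
      exact descent_bound_high hC₁ hd1 hmd hu1 hM hLpos hq₁0 hq₁le hk0 hkle i

/-! ### Weyl's inequality for all coefficients -/

/-- **The descent, iterated** (`r` steps down from the top coefficient): Weyl's estimate for the
coefficients of `X^i`, `d - r ≤ i ≤ d`. [cite: GreenTao2012Nilmanifolds, Proposition 4.3 (proof,
induction on r)] -/
theorem weyl_coeffs_from_top (d : ℕ) (hd : 1 ≤ d) :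
    ∀ r : ℕ, r + 1 ≤ d → ∃ (A : ℕ) (C : ℝ), 1 ≤ C ∧
      ∀ (δ : ℝ) (L : ℕ) (p : ℝ[X]), 0 < δ → δ ≤ 1 → p.natDegree ≤ d → 1 ≤ L →
        δ * L ≤ ‖∑ n ∈ Finset.Ioc (0 : ℤ) L, VdC.e (p.eval (n : ℝ))‖ →
        ∃ q : ℕ, 1 ≤ q ∧ (q : ℝ) ≤ C * (8 / δ ^ 2) ^ A ∧
          ∀ i, d - r ≤ i → i ≤ d → distInt (q * p.coeff i) ≤ C * (8 / δ ^ 2) ^ A / (L : ℝ) ^ i := by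
  intro r
  induction r with
  | zero =>
    intro _
    obtain ⟨A, C, hC, h⟩ := weyl_topCoeff d hd
    refine ⟨A, C, hC, fun δ L p hδ hδ1 hp hL hS => ?_⟩
    obtain ⟨k, hk1, hkle, hkd⟩ := h δ 0 L p hδ hδ1 hp hL (by rwa [zero_add])
    refine ⟨k, hk1, hkle, fun i hi1 hi2 => ?_⟩
    have : i = d := by omega
    subst this
    exact hkd
  | succ r ih =>
    intro hr
    obtain ⟨A₁, C₁, hC₁, hUP⟩ := ih (by omega)
    obtain ⟨A₂, C₂, hC₂, hTOP⟩ := weyl_topCoeff (d - (r + 1)) (by omega)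
    refine ⟨A₁ + A₂ + (2 * A₁ + 1) * d + A₁ * d,
      C₂ * 64 ^ A₂ * (128 * (d : ℝ) ^ 2 * C₁ ^ 2) ^ (2 * d + 1), ?_,
      fun δ L p hδ hδ1 hp hL hS => ?_⟩
    · obtain ⟨hM1, _⟩ := descent_M_facts (d := d) hC₁ hd rfl
      have h64 : (1 : ℝ) ≤ 64 ^ A₂ := one_le_pow₀ (by norm_num)
      calc (1 : ℝ) = 1 * 1 * 1 := by ring
        _ ≤ C₂ * 64 ^ A₂ * (128 * (d : ℝ) ^ 2 * C₁ ^ 2) ^ (2 * d + 1) :=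
            mul_le_mul (mul_le_mul hC₂ h64 zero_le_one (by positivity)) (one_le_pow₀ hM1)
              zero_le_one (by positivity)
    · have hUP' : ∀ (δ : ℝ) (L : ℕ) (p : ℝ[X]), 0 < δ → δ ≤ 1 → p.natDegree ≤ d → 1 ≤ L →
          δ * L ≤ ‖∑ n ∈ Finset.Ioc (0 : ℤ) L, VdC.e (p.eval (n : ℝ))‖ →
          ∃ q : ℕ, 1 ≤ q ∧ (q : ℝ) ≤ C₁ * (8 / δ ^ 2) ^ A₁ ∧
            ∀ i, d - (r + 1) < i → i ≤ d →
              distInt (q * p.coeff i) ≤ C₁ * (8 / δ ^ 2) ^ A₁ / (L : ℝ) ^ i := by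
        intro δ' L' p' h1 h2 h3 h4 h5
        obtain ⟨q, hq1, hq2, hq3⟩ := hUP δ' L' p' h1 h2 h3 h4 h5
        exact ⟨q, hq1, hq2, fun i hi hid => hq3 i (by omega) hid⟩
      obtain ⟨q, hq1, hqle, hqd⟩ :=
        weyl_descend (m := d - (r + 1)) (by omega) hC₁ hUP' hC₂ hTOP hδ hδ1 hL hp hS
      exact ⟨q, hq1, hqle, fun i hi hid => hqd i (by omega) hid⟩

/-- **Green–Tao 2012, Proposition 4.3 (Weyl's inequality, inverse form, all coefficients),
monomial-basis variant with existential constants.** For every `d ≥ 1` there are `A ∈ ℕ` and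
`C ≥ 1` such that: if `p ∈ ℝ[X]` has degree `≤ d`, `0 < δ ≤ 1`, `L ≥ 1` and
`‖∑_{0<n≤L} e(p(n))‖ ≥ δ L`, then there is `1 ≤ q ≤ C (8/δ²)^A` with
`‖q p_i‖_{ℝ/ℤ} ≤ C (8/δ²)^A / L^i` for every `1 ≤ i ≤ d`. (GT state this in the binomial basis
with the norms `‖·‖_{C^∞[N]}` and for an arbitrary polynomial sequence; the present interval is
`(0, L]` — for a general interval `(a, a+L]` apply it to `p(X + a)`.) This is the "standard
estimate for Weyl sums" invoked in the proof of Teräväinen 2024, Lemma 5.6: if `x` is minor-arc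
in the sense of loc. cit. then all the Weyl sums `∑_n e(j P_x(n))`, `j ≤ M₀`, are small.
[cite: GreenTao2012Nilmanifolds, Proposition 4.3 and Lemma 4.4]
[cite: Teravainen2024, §5.4, Lemma 5.6] -/
theorem weyl_allCoeffs (d : ℕ) (hd : 1 ≤ d) :
    ∃ (A : ℕ) (C : ℝ), 1 ≤ C ∧
      ∀ (δ : ℝ) (L : ℕ) (p : ℝ[X]), 0 < δ → δ ≤ 1 → p.natDegree ≤ d → 1 ≤ L →
        δ * L ≤ ‖∑ n ∈ Finset.Ioc (0 : ℤ) L, VdC.e (p.eval (n : ℝ))‖ →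
        ∃ q : ℕ, 1 ≤ q ∧ (q : ℝ) ≤ C * (8 / δ ^ 2) ^ A ∧
          ∀ i, 1 ≤ i → i ≤ d → distInt (q * p.coeff i) ≤ C * (8 / δ ^ 2) ^ A / (L : ℝ) ^ i := by
  obtain ⟨A, C, hC, h⟩ := weyl_coeffs_from_top d hd (d - 1) (by omega)
  refine ⟨A, C, hC, fun δ L p hδ hδ1 hp hL hS => ?_⟩
  obtain ⟨q, hq1, hqle, hqd⟩ := h δ L p hδ hδ1 hp hL hS
  exact ⟨q, hq1, hqle, fun i hi1 hi2 => hqd i (by omega) hi2⟩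

/-- **Minor arc ⟹ all Weyl sums are small** (the form used in Teräväinen 2024, Lemma 5.6,
"by the assumption `x ∈ 𝒳₂` and standard estimates for Weyl sums"): with the constants `A, C`
of `weyl_allCoeffs d`, if NO `1 ≤ q ≤ J₀ C (8/δ²)^A` makes all `‖q p_i‖_{ℝ/ℤ} ≤ C(8/δ²)^A/L^i`
(`1 ≤ i ≤ d`), then `‖∑_{0<n≤L} e(j p(n))‖ < δ L` for every `1 ≤ j ≤ J₀`.
[cite: GreenTao2012Nilmanifolds, Proposition 4.3] [cite: Teravainen2024, §5.4, Lemma 5.6] -/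
theorem weyl_sums_small_of_minorArc (d : ℕ) (hd : 1 ≤ d) :
    ∃ (A : ℕ) (C : ℝ), 1 ≤ C ∧
      ∀ (δ : ℝ) (L : ℕ) (p : ℝ[X]) (J₀ : ℕ), 0 < δ → δ ≤ 1 → p.natDegree ≤ d → 1 ≤ L →
        (∀ q : ℕ, 1 ≤ q → (q : ℝ) ≤ J₀ * (C * (8 / δ ^ 2) ^ A) →
          ∃ i, 1 ≤ i ∧ i ≤ d ∧ C * (8 / δ ^ 2) ^ A / (L : ℝ) ^ i < distInt (q * p.coeff i)) →
        ∀ j : ℕ, 1 ≤ j → j ≤ J₀ →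
          ‖∑ n ∈ Finset.Ioc (0 : ℤ) L, VdC.e (j * p.eval (n : ℝ))‖ < δ * L := by
  obtain ⟨A, C, hC, h⟩ := weyl_allCoeffs d hd
  refine ⟨A, C, hC, fun δ L p J₀ hδ hδ1 hp hL hminor j hj1 hjJ => ?_⟩
  by_contra hcon
  rw [not_lt] at hcon
  -- apply Weyl's inequality to `j · p`
  set p' : ℝ[X] := Polynomial.C (j : ℝ) * p with hp'
  have hp'deg : p'.natDegree ≤ d := (Polynomial.natDegree_C_mul_le _ _).trans hp
  have hsum : ∑ n ∈ Finset.Ioc (0 : ℤ) L, VdC.e (j * p.eval (n : ℝ)) =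
      ∑ n ∈ Finset.Ioc (0 : ℤ) L, VdC.e (p'.eval (n : ℝ)) := by
    refine Finset.sum_congr rfl fun n _ => ?_
    rw [hp', Polynomial.eval_mul, Polynomial.eval_C]
  rw [hsum] at hcon
  obtain ⟨q, hq1, hqle, hqd⟩ := h δ L p' hδ hδ1 hp'deg hL hcon
  obtain ⟨i, hi1, hid, hbad⟩ := hminor (q * j) (Nat.mul_pos hq1 hj1) (by
    push_cast
    have hjR : (j : ℝ) ≤ J₀ := by exact_mod_cast hjJ
    have hq0 : (0 : ℝ) ≤ q := Nat.cast_nonneg q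
    calc (q : ℝ) * j ≤ (C * (8 / δ ^ 2) ^ A) * J₀ := mul_le_mul hqle hjR (Nat.cast_nonneg j) (by positivity)
      _ = J₀ * (C * (8 / δ ^ 2) ^ A) := mul_comm _ _)
  have hcoeff : p'.coeff i = j * p.coeff i := by rw [hp', Polynomial.coeff_C_mul]
  have h1 := hqd i hi1 hid
  rw [hcoeff, ← mul_assoc] at h1
  have e : ((q * j : ℕ) : ℝ) = (q : ℝ) * j := by push_cast; ring
  rw [e] at hbad
  linarith

end Teravainen2024

end Literature.NumberTheory.Sieve
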